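import Literature.AlgebraicGeometry.Surfaces.K3TranscendentalHodgeSimilitudesKugaSatake
import Summits.HodgeConjecture.HodgeConjecture.Theorems.MarkmanPartnerTransportPicardThreeK3SquaresSimilitudeInvariance
import Summits.HodgeConjecture.HodgeConjecture.Theorems.MarkmanPartnerTransportPicardThreeK3SquaresSquareOfGenerator
import Summits.HodgeConjecture.HodgeConjecture.Theorems.Ring2AbelianAllAndreCorrespondenceCategory

/-!
# Route MarkmanPartnerTransport · crux `PicardThreeK3Squares` (stmt-HodgeConjecture-19652) —
# the K3-side twin of T1 «ORPH-KS»: a rational Hodge SELF-SIMILITUDE of `T(S)` is cycle-induced, and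
# HC⁴(S × S) holds for every real-QUADRATIC RM K3 square, GRANTED the Kuga–Satake statement for `S`

The crux (HC⁴ of `S × S`, `S` a projective K3 surface with `ρ(S) ≥ 3`) is open exactly on the
real-multiplication ranks `ρ(S) ∈ {4, 6, 7, 8, 10, 12, 13, 14, 16}` (`…RealMultiplicationRanksCorollaries`),
and by «one rational algebraic class suffices» (gen 8, `…OneAlgebraicClass`) what is missing on each RM
surface is ONE algebraic self-correspondence acting irrationally on `H^{2,0}`. When `E(S) = End_Hdg T(S)`
is REAL QUADRATIC, `E = ℚ(√d)` is generated by a Hodge SELF-SIMILITUDE `ψ = √d` (`(ψa · ψb) = d (a · b)`),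
and Varesco (Math. Z. 305 (2023), Thm. 5.3 = Cor. 4.6 for K3 surfaces, where Lefschetz "is trivially
true") proves: if the Kuga–Satake correspondence of `S` is algebraic, every Hodge similarity
`T(S) ⥲ T(S)` is algebraic. The X-side of the route has this as T1 «ORPH-KS» (`…OrphanKS`, `K3^{[2]}`-type
fourfolds, mod `IsKSCorrespondenceAlgebraicHK 2`); this file is the K3-SQUARE statement, which the tree
lacked:

* `isFujikiForm_markingForm` — the marking form `b_η(a, c) = (η a · η c)` of a marked K3 surface is a
  Fujiki form with `n = 1`; `mem_transcendentalPart_markingForm_iff` — its transcendental part is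
  `{y | y ∪ N¹(S) = 0}`.
* `exists_algebraicCorrespondence_eq_of_selfSimilitude_of_kugaSatake` — for a marked projective K3
  surface `(S, η, p, x)` satisfying the Kuga–Satake statement `IsKSCorrespondenceAlgebraicBetti` (Floccari's
  `H²_tr`-form; OPEN in print for a general K3 surface) and `ψ ∈ End H²(S(ℂ); ℂ)` rational,
  type-preserving, cup-self-adjoint, with image cup-orthogonal to `N¹(S)` and `ψ² = d ≠ 0` on `T(S)`:
  some algebraic self-correspondence of `S` agrees with `ψ` on `T(S)` — Varesco's Thm. 5.3 BY NAME
  (`Varesco2023_transcendentalHodgeSimilitude_algebraic_of_kugaSatake_K3`) applied to the Fujiki forms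
  `d • b_η`, `b_η` (`ψ` is bijective on `T(S)` since `ψ⁻¹ = d⁻¹ψ` there, and
  `b_η(ψa, ψc) = b_η(a, ψ²c) = d · b_η(a, c)`).
* `exists_corr_eq_on_transcendental_of_selfSimilitude_of_kugaSatake` — the same in the crux's spelling
  `[γ]_* = fst_*(snd^*(·) ∪ γ)` for the complex orientations, `γ ∈ A²(S × S)`
  (`IsAlgebraicCorrespondence.exists_eq_corrAction`).
* `isCycleInduced_of_selfSimilitude_of_kugaSatake` — if moreover `ψ` kills `N¹(S)`:
  **`IsCycleInducedTranscendentalEndomorphism S _ ψ`** (compose with the algebraic transcendental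
  projector: gen 5's `QuotientSimilitude.exists_corr_eq_of_eq_on_transcendental`).
* `hodgeConjectureFor_square_of_selfSimilitude_generator_of_kugaSatake` — if moreover
  `End_Hdg T(S) = ℚ[ψ]` (`TranscendentalEndomorphismsGeneratedBy S ψ`, i.e. `E(S) = ℚ + ℚψ` real
  quadratic): **`HodgeConjectureFor 4 (S ⊗ S)`** by F4 (`SquareOfGenerator.hodgeConjectureFor_tensor_self_of_generated`).

Consequence for the crux's residue map: every REAL-QUADRATIC RM K3 square (`[E(S):ℚ] = 2`, possible at
`ρ(S) ∈ {4, 6, 8, 10, 12, 14, 16}`) moves from OPEN to CONDITIONAL ON THE KUGA–SATAKE STATEMENT FOR `S`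
(an abelian-variety-sector statement: Kuga–Satake Hodge conjecture, van Geemen 2000 §10, Varesco 2023
Conj. 4.2); modulo it, the crux's open core is RM of degree `≥ 3` (`ρ(S) ∈ {4, 6, 7, 10, 13}`).

CONDITIONAL on `IsKSCorrespondenceAlgebraicBetti` (hypothesis) and the named fact
`Varesco2023_transcendentalHodgeSimilitude_algebraic_of_kugaSatake_K3`; no definition, no sorry, no new
named fact; credits nothing to the Hodge conjecture — nothing here says HC or the crux is proved. Prover
seat hodge-nonav-19652-p1 (gen 9), `--supports stmt-HodgeConjecture-19652`.

References: M. Varesco, *Hodge similarities, algebraic classes, and Kuga–Satake varieties*, Math. Z. 305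
(2023) art. 69, Def. 1.2, Conj. 4.2, Cor. 4.6, Thm. 5.3; S. Floccari, Geom. Topol. 30 (2026) §3.3 Rem.
3.4; B. van Geemen, in: *The arithmetic and geometry of algebraic cycles* (2000), §10.2–10.3; van
Geemen–Schütt, Forum Math. Sigma 13 (2025) e2, §2.1, §4.8; Yu. G. Zarhin, J. reine angew. Math. 341
(1983) Thm. 1.5.1; W. Fulton, *Intersection theory*, §16.1 Prop. 16.1.1.
-/

set_option linter.dupNamespace false

noncomputable section

namespace Summit.HodgeConjecture.HodgeConjecture.Theorems.MarkmanPartnerTransport.KugaSatakeSimilitude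

open Module CategoryTheory MonoidalCategory CartesianMonoidalCategory
open Literature.AlgebraicGeometry Literature.AlgebraicGeometry.Motives Literature.AlgebraicGeometry.HodgeTheory
open Literature.AlgebraicGeometry.Hyperkaehler Literature.AlgebraicGeometry.Surfaces
open Literature.AlgebraicTopology.SingularHomology
open Summit.HodgeConjecture.HodgeConjecture.Theorems
open Summit.HodgeConjecture.HodgeConjecture.Theorems.MarkmanPartnerTransport

variable {S : SchemeOver ℂ} {η : complexBetti S (2 * 1) ≃ₗ[ℂ] (K3Index → ℂ)} {p : complexBetti S (2 * 2)}
  {x : K3Index → ℂ}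

/-- `MarkedK3[S, η, p, x]`: VERBATIM the `let MarkedK3 := …` binder of the route declaration
`PicardThreeK3Squares`. Local notation only. -/
local notation3 (prettyPrint := false) "MarkedK3[" S ", " η ", " p ", " x "]" =>
  (p ≠ 0 ∧ (IsIntegralClass p ∧
    (∀ q : complexBetti S (2 * 2), IsIntegralClass q → ∃ n : ℤ, q = n • p) ∧
    (∀ c : complexBetti S (2 * 1), IsIntegralClass c ↔ ∃ v : K3Index → ℤ, η c = fun i => (v i : ℂ)) ∧
    (∀ a b : complexBetti S (2 * 1),
      cupProduct (rfl : 2 * 1 + 2 * 1 = 2 * 2) a b = k3Form (η a) (η b) • p) ∧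
    IsOfHodgeType 2 S (2 * 1) 2 0 (LinearEquiv.symm η x) ∧
    (∀ τ : complexBetti S (2 * 1), IsOfHodgeType 2 S (2 * 1) 2 0 τ →
      ∃ t : ℂ, τ = t • LinearEquiv.symm η x)) ∧
    (k3Form x x = 0 ∧ 0 < (k3Form (star x) x).re ∧
      ∃ u : K3Index → ℤ, k3Form (fun i => (u i : ℂ)) x = 0 ∧ 0 < ∑ i, ∑ j, u i * k3Gram i j * u j))

/-- `Corr[μ, hS ; γ, y] = fst_*(snd^* y ∪ γ)` on `H²(S(ℂ); ℂ)` (`hS : IsSmoothProjective 2 S`). Local notation only. -/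
local notation3 (prettyPrint := false) "Corr[" μ ", " hS " ; " γ ", " y "]" =>
  complexGysin μ (IsSmoothProjective.tensor_holds hS hS) hS
    (SemiCartesianMonoidalCategory.fst _ _) (rfl : 2 * 1 + 2 * 2 + 2 * 2 = 2 * 1 + 2 * (2 + 2))
    (cupProduct (rfl : 2 * 1 + 2 * 2 = 2 * 1 + 2 * 2)
      (complexBetti.map (SemiCartesianMonoidalCategory.snd _ _) (2 * 1) y) γ)

/-- `Transc[S, y]`: `y` is cup-orthogonal to `N¹(S) = algebraicClasses S 1`. Local notation only. -/
local notation3 (prettyPrint := false) "Transc[" S ", " y "]" =>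
  (∀ d ∈ algebraicClasses S 1, cupProduct (rfl : 2 * 1 + 2 * 1 = 2 * 2) y d = 0)

/-! ### §1 The marking form is a Fujiki form, and its transcendental part -/

/-- `bη[η] = (·.·) ∘ (η × η)`: the marking form as a `ℂ`-bilinear map on `H²(S(ℂ); ℂ)` (a term, not a
definition). Local notation only. -/
local notation3 (prettyPrint := false) "bη[" η "]" =>
  LinearMap.compl₁₂ k3FormC (LinearEquiv.toLinearMap η) (LinearEquiv.toLinearMap η)

/-- `bη[η](a, c) = (η a · η c)`. [cite: Huybrechts2016K3, Ch. 6 §1.1] -/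
theorem markingForm_apply (η : complexBetti S (2 * 1) ≃ₗ[ℂ] (K3Index → ℂ)) (a c : complexBetti S (2 * 1)) :
    bη[η] a c = k3Form (η a) (η c) := by
  rw [LinearMap.compl₁₂_apply, LinearEquiv.coe_toLinearMap, k3FormC_apply]

/-- **The marking form of a marked K3 surface is a Fujiki form with `n = 1`**: symmetric, and
`a ∪ a = (η a · η a) · p` with `p ≠ 0` is the cup clause of the marking. [cite: Huybrechts2016K3, Ch. 1 Prop. 3.5]
[cite: Huybrechts1999, §1.11] -/
theorem isFujikiForm_markingForm (hM : MarkedK3[S, η, p, x]) : IsFujikiForm 1 S (bη[η]) := by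
  obtain ⟨hp0, ⟨-, -, -, hηcup, -, -⟩, -⟩ := hM
  refine ⟨fun a c => ?_, 1, p, one_ne_zero, hp0, fun a => ?_⟩
  · rw [markingForm_apply, markingForm_apply, k3Form_comm]
  · change cupPowTwo a 2 = _
    rw [cupPowTwo_two, pow_one, one_mul, markingForm_apply]
    exact hηcup a a

/-- **The transcendental part of the marking form is `T(S) = {y | y ∪ N¹(S) = 0}`**
(`transcendentalPart_eq_transcendentalSubspace` and `mem_transcendentalSubspace_iff_forall_algebraicClasses`).
[cite: Floccari2026, §3.3 Rem. 3.4] -/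
theorem mem_transcendentalPart_markingForm_iff (hS : IsSmoothProjective 2 S) (hM : MarkedK3[S, η, p, x])
    (y : complexBetti S (2 * 1)) : y ∈ transcendentalPart S (bη[η]) ↔ Transc[S, y] := by
  rw [transcendentalPart_eq_transcendentalSubspace (isFujikiForm_markingForm hM)]
  exact mem_transcendentalSubspace_iff_forall_algebraicClasses hS y

/-! ### §2 Varesco's Thm. 5.3 for a self-similitude: `ψ` is algebraic on `T(S)`, modulo Kuga–Satake -/

/-- **A rational Hodge self-similitude of `T(S)` is algebraic on `T(S)`, granted Kuga–Satake for `S`**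
(Varesco form). Data: a marked projective K3 surface `(S, η, p, x)` whose Kuga–Satake correspondence is
algebraic (`IsKSCorrespondenceAlgebraicBetti`, hypothesis), and `ψ ∈ End H²(S(ℂ); ℂ)` rational,
Hodge-type preserving, cup-self-adjoint, with image cup-orthogonal to `N¹(S)` and `ψ(ψ y) = d • y` for
`y ∈ T(S)`, `d ≠ 0`. Then `ψ|_{T(S)}` is a rational Hodge similitude of multiplier `d` — bijective on
`T(S)` (`ψ⁻¹ = d⁻¹ψ` there), isometric for the Fujiki forms `d • b_η`, `b_η`
(`b_η(ψa, ψc) = b_η(a, ψ²c) = d · b_η(a, c)`) — so Varesco's Thm. 5.3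
(`Varesco2023_transcendentalHodgeSimilitude_algebraic_of_kugaSatake_K3`, BY NAME) gives an algebraic
self-correspondence `T` of `S` with `T y = ψ y` on `T(S)`. CONDITIONAL (Kuga–Satake hypothesis; fact
Varesco2023). [cite: Varesco2023, Thm. 5.3 (§5), Cor. 4.6 and Def. 1.2] [cite: Floccari2026, §3.3 Rem. 3.4] -/
theorem exists_algebraicCorrespondence_eq_of_selfSimilitude_of_kugaSatake
    (hVar : Varesco2023_transcendentalHodgeSimilitude_algebraic_of_kugaSatake_K3)
    (hS : IsK3Surface S) (hM : MarkedK3[S, η, p, x])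
    (hKS : IsKSCorrespondenceAlgebraicBetti hS.isSmoothProjective)
    (ψ : complexBetti S (2 * 1) →ₗ[ℂ] complexBetti S (2 * 1))
    (h1 : ∀ y, IsRationalClass y → IsRationalClass (ψ y))
    (h2 : ∀ (i j : ℕ) y, IsOfHodgeType 2 S (2 * 1) i j y → IsOfHodgeType 2 S (2 * 1) i j (ψ y))
    (h4 : ∀ y : complexBetti S (2 * 1), Transc[S, ψ y])
    (h5 : ∀ y w : complexBetti S (2 * 1),
      cupProduct (rfl : 2 * 1 + 2 * 1 = 2 * 2) (ψ y) w = cupProduct (rfl : 2 * 1 + 2 * 1 = 2 * 2) y (ψ w))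
    (d : ℚ) (hd : d ≠ 0) (hψψ : ∀ y : complexBetti S (2 * 1), Transc[S, y] → ψ (ψ y) = (d : ℂ) • y) :
    ∃ T : complexBetti S (2 * 1) →ₗ[ℂ] complexBetti S (2 * 1), IsAlgebraicCorrespondence 2 2 S S T ∧
      ∀ y : complexBetti S (2 * 1), Transc[S, y] → T y = ψ y := by
  classical
  obtain ⟨hp0, ⟨-, -, -, hηcup, -, -⟩, -⟩ := id hM
  have hb : IsFujikiForm 1 S (bη[η]) := isFujikiForm_markingForm hM
  have hd' : (d : ℂ) ≠ 0 := by exact_mod_cast hd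
  have hb₁ : IsFujikiForm 1 S ((d : ℂ) • bη[η]) := hb.smul hd'
  have hmem : ∀ y : complexBetti S (2 * 1), y ∈ transcendentalSubspace S ↔ Transc[S, y] :=
    fun y => mem_transcendentalSubspace_iff_forall_algebraicClasses hS.isSmoothProjective y
  -- `ψ` maps `T(S)` bijectively onto itself
  have hmaps : Set.MapsTo ψ (transcendentalSubspace S : Set (complexBetti S (2 * 1)))
      (transcendentalSubspace S : Set (complexBetti S (2 * 1))) :=
    fun y _ => (hmem _).2 (h4 y)
  have hinj : Set.InjOn ψ (transcendentalSubspace S : Set (complexBetti S (2 * 1))) := by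
    intro y hy y' hy' h
    have h' := congrArg ψ h
    rw [hψψ y ((hmem y).1 hy), hψψ y' ((hmem y').1 hy')] at h'
    exact smul_right_injective _ hd' h'
  have hsurj : Set.SurjOn ψ (transcendentalSubspace S : Set (complexBetti S (2 * 1)))
      (transcendentalSubspace S : Set (complexBetti S (2 * 1))) := by
    intro y hy
    refine ⟨(d : ℂ)⁻¹ • ψ y, (transcendentalSubspace S).smul_mem _ ((hmem _).2 (h4 y)), ?_⟩
    show ψ ((d : ℂ)⁻¹ • ψ y) = y
    rw [map_smul, hψψ y ((hmem y).1 hy), smul_smul, inv_mul_cancel₀ hd', one_smul]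
  have hbij : Set.BijOn ψ (transcendentalSubspace S : Set (complexBetti S (2 * 1)))
      (transcendentalSubspace S : Set (complexBetti S (2 * 1))) := ⟨hmaps, hinj, hsurj⟩
  -- the marking form is read off the cup product: `(a ∪ c) = b_η(a, c) • p`, `p ≠ 0`
  have hform : ∀ a c : complexBetti S (2 * 1), ∀ s : ℂ,
      cupProduct (rfl : 2 * 1 + 2 * 1 = 2 * 2) a c = s • p → bη[η] a c = s := by
    intro a c s h
    rw [hηcup, ← markingForm_apply] at h
    exact smul_left_injective ℂ hp0 h
  -- `ψ` is a similitude of multiplier `d`: `b_η(ψ a, ψ c) = (d • b_η)(a, c)` on `T(S)`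
  have hiso : ∀ a ∈ transcendentalSubspace S, ∀ c ∈ transcendentalSubspace S,
      bη[η] (ψ a) (ψ c) = ((d : ℂ) • bη[η]) a c := by
    intro a _ c hc
    rw [LinearMap.smul_apply, LinearMap.smul_apply, smul_eq_mul]
    refine hform _ _ _ ?_
    rw [h5, hψψ c ((hmem c).1 hc), map_smul, hηcup, ← markingForm_apply, smul_smul]
  obtain ⟨T, hTalg, hTψ⟩ :=
    Varesco2023_transcendentalHodgeSimilitude_algebraic_of_kugaSatake_K3.of_transcendentalSubspace hVar hS hS
      hKS hKS hb₁ hb (ψ := ψ) (fun y _ hy => h1 y hy) hbij (fun i j y _ hy => h2 i j y hy) hiso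
  exact ⟨T, hTalg, fun y hy => hTψ y ((hmem y).2 hy)⟩

/-- `[γ]_*` in the crux's spelling is the tree's `corrAction` at `a = b = 2` (by `rfl`). [cite: VoisinHodgeII2003, proof of Thm. 10.17 (10.7)] -/
theorem corr_eq_corrAction_two (hS : IsSmoothProjective 2 S) (hab : 2 + 2 * 2 = 2 + 2 * 2)
    (γ : complexBetti (S ⊗ S) (2 * 2)) (y : complexBetti S (2 * 1)) :
    Corr[complexOrientationFamily, hS ; γ, y] = corrAction complexOrientationFamily hS hS hab γ y :=
  rfl

/-- **A rational Hodge self-similitude of `T(S)` is `[γ]_*` on `T(S)` for an algebraic `γ ∈ A²(S × S)`,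
granted Kuga–Satake for `S`** — the previous theorem in the crux's spelling `[γ]_* = fst_*(snd^*(·) ∪ γ)`
for the complex orientations (`IsAlgebraicCorrespondence.exists_eq_corrAction`; degree `e = 2` forced).
CONDITIONAL (Kuga–Satake hypothesis; fact Varesco2023). [cite: Varesco2023, Thm. 5.3 (§5)]
[cite: Fulton1998, §16.1 Prop. 16.1.1] -/
theorem exists_corr_eq_on_transcendental_of_selfSimilitude_of_kugaSatake
    (hVar : Varesco2023_transcendentalHodgeSimilitude_algebraic_of_kugaSatake_K3)
    (hS : IsK3Surface S) (hM : MarkedK3[S, η, p, x])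
    (hKS : IsKSCorrespondenceAlgebraicBetti hS.isSmoothProjective)
    (ψ : complexBetti S (2 * 1) →ₗ[ℂ] complexBetti S (2 * 1))
    (h1 : ∀ y, IsRationalClass y → IsRationalClass (ψ y))
    (h2 : ∀ (i j : ℕ) y, IsOfHodgeType 2 S (2 * 1) i j y → IsOfHodgeType 2 S (2 * 1) i j (ψ y))
    (h4 : ∀ y : complexBetti S (2 * 1), Transc[S, ψ y])
    (h5 : ∀ y w : complexBetti S (2 * 1),
      cupProduct (rfl : 2 * 1 + 2 * 1 = 2 * 2) (ψ y) w = cupProduct (rfl : 2 * 1 + 2 * 1 = 2 * 2) y (ψ w))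
    (d : ℚ) (hd : d ≠ 0) (hψψ : ∀ y : complexBetti S (2 * 1), Transc[S, y] → ψ (ψ y) = (d : ℂ) • y) :
    ∃ γ ∈ algebraicClasses (S ⊗ S) 2, ∀ y : complexBetti S (2 * 1), Transc[S, y] →
      Corr[complexOrientationFamily, hS.isSmoothProjective ; γ, y] = ψ y := by
  obtain ⟨T, hTalg, hTψ⟩ := exists_algebraicCorrespondence_eq_of_selfSimilitude_of_kugaSatake hVar hS hM hKS ψ
    h1 h2 h4 h5 d hd hψψ
  obtain ⟨e, hab, γ, hγ, hT⟩ :=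
    Summit.HodgeConjecture.HodgeConjecture.Ring2.AbelianAll.IsAlgebraicCorrespondence.exists_eq_corrAction
      hS.isSmoothProjective hS.isSmoothProjective hTalg
  obtain rfl : e = 2 := by omega
  refine ⟨γ, hγ, fun y hy => ?_⟩
  rw [corr_eq_corrAction_two hS.isSmoothProjective hab, ← hTψ y hy, hT]

/-! ### §3 A self-similitude killing `N¹(S)` is cycle-induced; HC⁴(S × S) for real-quadratic `E(S)` -/

/-- **A rational Hodge self-similitude of `T(S)`, extended by `0` on `N¹(S)`, is CYCLE-INDUCED, granted
Kuga–Satake for `S`**: with `ψ` as above and ALSO `ψ = 0` on `N¹(S)`, some algebraic `γ' ∈ A²(S × S)` has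
`[γ']_* = ψ` on ALL of `H²(S(ℂ); ℂ)` (compose the class of §2 with the algebraic transcendental projector,
`QuotientSimilitude.exists_corr_eq_of_eq_on_transcendental`; `H² = N¹ + T`), so
`IsCycleInducedTranscendentalEndomorphism S _ ψ` — the form consumed by F4 / «one cycle suffices».
CONDITIONAL (Kuga–Satake hypothesis; fact Varesco2023). [cite: Varesco2023, Thm. 5.3 (§5) and §2 (p. 8)]
[cite: GeemenSchutt2023, §4.8] -/
theorem isCycleInduced_of_selfSimilitude_of_kugaSatake
    (hVar : Varesco2023_transcendentalHodgeSimilitude_algebraic_of_kugaSatake_K3)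
    (hS : IsK3Surface S) (hM : MarkedK3[S, η, p, x])
    (hKS : IsKSCorrespondenceAlgebraicBetti hS.isSmoothProjective)
    (ψ : complexBetti S (2 * 1) →ₗ[ℂ] complexBetti S (2 * 1))
    (h1 : ∀ y, IsRationalClass y → IsRationalClass (ψ y))
    (h2 : ∀ (i j : ℕ) y, IsOfHodgeType 2 S (2 * 1) i j y → IsOfHodgeType 2 S (2 * 1) i j (ψ y))
    (h3 : ∀ d ∈ algebraicClasses S 1, ψ d = 0)
    (h4 : ∀ y : complexBetti S (2 * 1), Transc[S, ψ y])
    (h5 : ∀ y w : complexBetti S (2 * 1),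
      cupProduct (rfl : 2 * 1 + 2 * 1 = 2 * 2) (ψ y) w = cupProduct (rfl : 2 * 1 + 2 * 1 = 2 * 2) y (ψ w))
    (d : ℚ) (hd : d ≠ 0) (hψψ : ∀ y : complexBetti S (2 * 1), Transc[S, y] → ψ (ψ y) = (d : ℂ) • y) :
    IsCycleInducedTranscendentalEndomorphism S hS.isSmoothProjective ψ := by
  obtain ⟨γ, hγ, hγψ⟩ := exists_corr_eq_on_transcendental_of_selfSimilitude_of_kugaSatake hVar hS hM hKS ψ h1 h2
    h4 h5 d hd hψψ
  have hγψ' : ∀ y ∈ transcendentalSubspace S, Corr[complexOrientationFamily, hS.isSmoothProjective ; γ, y] = ψ y :=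
    fun y hy => hγψ y ((mem_transcendentalSubspace_iff_forall_algebraicClasses hS.isSmoothProjective y).1 hy)
  obtain ⟨γ', hγ', hγ'ψ⟩ := QuotientSimilitude.exists_corr_eq_of_eq_on_transcendental hS hS ψ h3 hγ hγψ'
  exact ⟨h1, h2, h3, h4, γ', hγ', fun y => (hγ'ψ y).symm⟩

/-- **HC⁴(S × S) for a projective K3 surface with REAL-QUADRATIC endomorphism field, granted Kuga–Satake
for `S`.** Data: a marked projective K3 surface `(S, η, p, x)` with algebraic Kuga–Satake correspondence
(`IsKSCorrespondenceAlgebraicBetti`, hypothesis) and `ψ ∈ End H²(S(ℂ); ℂ)` rational, type-preserving,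
killing `N¹(S)`, with image cup-orthogonal to `N¹(S)`, cup-self-adjoint, `ψ² = d ≠ 0` on `T(S)`, and
GENERATING: `End_Hdg T(S) = ℚ[ψ|_T] = ℚ + ℚψ` (`TranscendentalEndomorphismsGeneratedBy S ψ`; for a
non-square `d > 0` this is `E(S) = ℚ(√d)`, the real-quadratic RM case). Then `HodgeConjectureFor 4 (S ⊗ S)`:
`ψ` is cycle-induced (`isCycleInduced_of_selfSimilitude_of_kugaSatake`) and F4
(`SquareOfGenerator.hodgeConjectureFor_tensor_self_of_generated`: powers of an algebraic
self-correspondence are algebraic, Künneth bookkeeping over `ℚ[ψ]`) concludes. CONDITIONAL on the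
Kuga–Satake statement for `S` (open in print) and the fact Varesco2023; the K3-square twin of
`OrphanKS.hodgeConjectureFor_of_quadraticEndomorphismField_of_kugaSatake`. Credits nothing to HC.
[cite: Varesco2023, Thm. 5.3, Cor. 4.6, Conj. 4.2] [cite: GeemenSchutt2023, §2.1 and §4.8]
[cite: Fulton1998, §16.1 Prop. 16.1.1] -/
theorem hodgeConjectureFor_square_of_selfSimilitude_generator_of_kugaSatake
    (hVar : Varesco2023_transcendentalHodgeSimilitude_algebraic_of_kugaSatake_K3)
    (hS : IsK3Surface S) (hM : MarkedK3[S, η, p, x])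
    (hKS : IsKSCorrespondenceAlgebraicBetti hS.isSmoothProjective)
    (ψ : complexBetti S (2 * 1) →ₗ[ℂ] complexBetti S (2 * 1))
    (h1 : ∀ y, IsRationalClass y → IsRationalClass (ψ y))
    (h2 : ∀ (i j : ℕ) y, IsOfHodgeType 2 S (2 * 1) i j y → IsOfHodgeType 2 S (2 * 1) i j (ψ y))
    (h3 : ∀ d ∈ algebraicClasses S 1, ψ d = 0)
    (h4 : ∀ y : complexBetti S (2 * 1), Transc[S, ψ y])
    (h5 : ∀ y w : complexBetti S (2 * 1),
      cupProduct (rfl : 2 * 1 + 2 * 1 = 2 * 2) (ψ y) w = cupProduct (rfl : 2 * 1 + 2 * 1 = 2 * 2) y (ψ w))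
    (d : ℚ) (hd : d ≠ 0) (hψψ : ∀ y : complexBetti S (2 * 1), Transc[S, y] → ψ (ψ y) = (d : ℂ) • y)
    (hgen : TranscendentalEndomorphismsGeneratedBy S ψ) :
    HodgeConjectureFor 4 (S ⊗ S) :=
  SquareOfGenerator.hodgeConjectureFor_tensor_self_of_generated hS ψ
    (isCycleInduced_of_selfSimilitude_of_kugaSatake hVar hS hM hKS ψ h1 h2 h3 h4 h5 d hd hψψ) hgen

end Summit.HodgeConjecture.HodgeConjecture.Theorems.MarkmanPartnerTransport.KugaSatakeSimilitude

end
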